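import Literature.NumberTheory.GelbartRogawski1991.DoubledWeilRepresentationArchVacuumUndoubling
import Literature.NumberTheory.GelbartRogawski1991.DoubledWeilRepresentationUndoublingArch
import Literature.NumberTheory.Automorphic.Liu2021.Def411WeilCarriersCentralTypeRigidityWeightOne
import Literature.NumberTheory.Automorphic.IdeleClassCharacterHecke
import HarnessLib

/-!
# The CENTRAL TYPE of the splitting attached to a character, on the archimedean Gaussian
# ([Liu2021, App. D Step 2, Lem. D.2]; [KonnoKonno2007, Lem. 5.2]; [GelbartRogawski1991, Prop. 3.1.1] by doubling)

Topic `NumberTheory/Automorphic/Liu2021`; namespace `Literature.NumberTheory.GelbartRogawski1991.GRConstruction` (the objects are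
the doubling construction's).  KERNEL ONLY: proved theorems and three definitions with bodies (`realPlaceUnder`, `realPlaceEquiv`,
`centralType`); 0 records, 0 `def … : Prop`, 0 named facts, 0 `sorry`.

[Liu2021, App. D §D.1 Step 2] attaches to a conjugate-symplectic character `μ` the splitting `ι_μ : U(V) → Mp(V ⊗ W₁)` "determined
by doubling" ([HarrisKudlaSweet1996, §1]); the tree's term is `ι_χ := chiSplitting χ = undoubleHom (doubledWeilRep χ)`
(`Liu2021/Def411WeilCarriersDoubling`), transported to a hermitian line as `chiSplittingLine χ T_W J_W`.  The rigidity leaf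
`Liu2021/Def411WeilCarriersCentralTypeRigidity` reduces the archimedean-type bookkeeping of [Liu2021, Def. 4.1–4.3] along a
central-type fibre to ONE input `h₀`: the character by which the archimedean centre `(t · 1_V, 1)`, `t ∈ U(1)(L⁺ ⊗ ℝ)`, acts
through `ω_ψ ∘ ι_χ` on ONE non-zero vector.  THIS FILE COMPUTES IT on the Gaussian:

* § 1 **`omega_chiSplitting_centerPair_gaussianV_tmul`**: for `χ` unitary, `χ|_{𝕀_{L⁺}} = ε`, of odd unitary archimedean type
  `(τ, 0)`, `ω(ι_χ((t · 1_V) ⊗ 1_W))(G_𝕍 ⊗ f) = (η_τ(k_t) · vac (sectionD k_t)) • (G_𝕍 ⊗ f)` for EVERY finite test function `f` —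
  the undoubling (`omega_undouble_tmul_eq_smul_of_arch`) of the doubled vacuum character: THE `χ`-normalised doubled Weil
  representation at the archimedean element `k_t` IS the explicit half `archHalfOf τ` (`doubledWeilRep_archToAdelic_eq_archHalfOf`,
  `omega_archHalfOf_tmul`), which acts on `R_{e₂}(G_𝕍 ⊠ G_𝕍) = h₀ ∘ frameD` (`schwartzReindexCLM_archBoxTensor_gaussianV`) by
  `η_τ(k_t) · vac (sectionD k_t)` ([Folland1989, Prop. (4.39)]: `MpS.apply_hermitePi_zero_of_proj_eq_realifySp` at the unitary phase
  map `exists_proj_sectionD_archK`);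
* § 2 the eigenvalue as a typed weight: **`etaD_mul_vac_archK : η_τ(k_t) · vac (sectionD k_t) = archWeight L (centralType τ) t`**,
  `centralType τ w := n (τ_w + 1)/2 − q_{v(w)}` (`= (n τ_w + p_{v(w)} − q_{v(w)})/2`: [KonnoKonno2007, Lem. 5.2]'s `p e_P + q e_Q` with
  `(e_P, e_Q) = ((τ_w + 1)/2, (τ_w − 1)/2)`), through `v ↦ w(v)` : real places of `L⁺` ≃ infinite places of `L` (`realPlaceEquiv`);
* § 3 the pair-representation forms **`pairRep_chiSplitting_center_gaussianV_tmul`** (lane datum `(diag dV, diag dW)`),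
  **`pairRep_chiSplittingLine_center_gaussianV_tmul`** (hermitian line `⟨T_W⟩`) and **`…_cm`** (CM currency `T_W := realDiagonal dW`)
  — LITERALLY the hypothesis `h₀` of `exists_eq_chiSplittingLine_archType_of_center` ∕ `…_archTrivial_of_center_eq[_cm]` ∕
  `…_twist_weightOne_of_center_eq[_cm]` at `Φ₀ := G_𝕍 ⊗ f`, with the EXPLICIT type `centralType τ`;
* § 4 weight-one base characters: **`pairRep_chiSplittingLine_toHeckeCharacter_center_gaussianV_tmul_cm`** (the `h₀` of
  `Def411WeilCarriersCentralTypeRigidityWeightOne` for `μ₀` conjugate symplectic of weight one with CM type `Φ`, type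
  `centralType (weightOneType Φ)`) and the composite **`exists_eq_chiSplittingLine_twist_weightOne_of_center_gaussianV_cm`** —
  X3-Char item (E) at a Gram scalar WITH NO ANALYTIC HYPOTHESIS: every continuous compatible splitting with that central character
  on one Gaussian test tensor is `ι_μ`, `μ` conjugate symplectic OF WEIGHT ONE with `Φ_μ = Φ`.

Consequence for the COR-CM Δ2 bridge (X3-Char item (E)): with `Liu2021/Def411WeilCarriersCentralTypeRigidity[WeightOne]` and
`Automorphic/UnitaryGroupAdelicCharactersArchType[Twist]`, every continuous compatible splitting in the central-type fibre of
`centralType τ` at a Gram class is `ι_μ` with `μ` conjugate symplectic of weight one and of the CM type of the base character — the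
analytic input (E1) is no longer a hypothesis (§ 4); what remains at the COR-CM pin is transport — the frame junction
`gaussianAt = gaussianV`, `testFun = Φ ⊗ 𝟙_coset` — and the index arithmetic `centralType (weightOneType Φ^δ(q)) = muLiu q` (port-gated).  HC_CM is NOT proved here or anywhere in the tree.
References: Y. Liu, Camb. J. Math. 9 (2021), §4.1 Def. 4.1–4.3, Remark 4.2, App. D §D.1 Step 2 (l. 5219), Lem. D.2 [Liu2021];
K. Konno, T. Konno, Kyushu J. Math. 61 (2007), Lemma 5.2 p. 73 [KonnoKonno2007]; S. Gelbart, J. Rogawski, Invent. Math. 105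
(1991), §3.1 Prop. 3.1.1, Remark p. 457 [GelbartRogawski1991]; S. Kudla, Israel J. Math. 87 (1994), §3 Thm. 3.1 [Kudla1994];
G. B. Folland, *Harmonic Analysis in Phase Space* (1989), §4.2 Prop. (4.39) [Folland1989]; A. Paul, J. Funct. Anal. 159 (1998), §1.2
(1.2.1)–(1.2.2) [Paul1998].  Provenance: pub-hodgecm2 (COR-CM) cell, seat pin-3 (gen 9), X3-Char item (E) = (E1) analytic input.
-/

set_option autoImplicit false

noncomputable section

open scoped Classical
open scoped Matrix Kronecker TensorProduct SchwartzMap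
open NumberField NumberField.InfinitePlace NumberField.mixedEmbedding IsDedekindDomain
open Literature.RepresentationTheory.HeisenbergGroup
open Literature.NumberTheory.Automorphic
open Literature.NumberTheory.Weil1964
open Literature.RepresentationTheory.HarrisKudlaSweet1996
open Literature.NumberTheory.GaloisRepresentations
open Literature.Analysis.SegalBargmann

namespace Literature.NumberTheory.GelbartRogawski1991.GRConstruction

open UnitaryDualPair UnitaryDualPair.ArchSplitting
open Literature.NumberTheory.GelbartRogawski1991.UnitaryDualPair.LocalSplitting
open Literature.NumberTheory.Automorphic.Liu2021.Def411WeilCarriersDoubling (archUnit coe_archUnit)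

variable (L : Type) [Field L] [NumberField L] [IsCMField L]

variable {N M n : ℕ} (e : Fin N × Fin M ≃ Fin n)
  (dV : Fin N → L) (hdV : ∀ i, IsCMField.complexConj L (dV i) = dV i) (hdV0 : ∀ i, dV i ≠ 0)
  (dW : Fin M → L) (hdW : ∀ i, IsCMField.complexConj L (dW i) = dW i) (hdW0 : ∀ i, dW i ≠ 0)

/-! ## §1 The undoubled eigenvalue on the Gaussian -/

section Assembly

open UnitaryDualPair.ArchSplitting
open Literature.NumberTheory.Automorphic.Liu2021.Def411WeilCarriersDoubling (doubledWeilRep chiSplitting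
  isDoubledWeilRep_doubledWeilRep)

set_option maxHeartbeats 2000000 in
-- (the `show`/`refine` steps unify `chiSplitting χ g` with `undouble … g` and the (A5) statement through the doubled telescope)
/-- **THE ARCHIMEDEAN CENTRE THROUGH THE SPLITTING ATTACHED TO `χ`, ON THE GAUSSIAN** (lane datum `(diag dV, diag dW)`):
for `χ` unitary with `χ|_{𝕀_{L⁺}} = ε` and odd unitary archimedean type `(τ, 0)`, the element `((t · 1_V) ⊗ 1_W)`, `t ∈ U(1)(L⁺ ⊗ ℝ)`, acts
through `ι_χ = chiSplitting χ` on every pure tensor `G_𝕍 ⊗ f` (`G_𝕍` the archimedean Gaussian of the pair, `f` any finite test function)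
by the SCALAR `η_τ(k_t) · vac (sectionD k_t)` — undoubling (`A5`) of the doubled vacuum character (`A2`, `A3`, `A4`) along
`R_{e₂}(G_𝕍 ⊠ G_𝕍) = G^𝔻`. [cite: GelbartRogawski1991, §3.1 Prop. 3.1.1 p. 455, Remark p. 457 L9–13] [cite: Kudla1994, §3 Thm. 3.1]
[cite: Folland1989, §4.2 Prop. (4.39)] [cite: KonnoKonno2007, Lemma 5.2 p. 73] -/
theorem omega_chiSplitting_centerPair_gaussianV_tmul {χ : HeckeCharacter L} (hχu : χ.IsUnitary) (hχs : IsSplittingChar L 1 χ)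
    {τ : InfinitePlace L → ℤ} (hτ : χ.HasUnitaryArchType τ 0) (hodd : ∀ w, Odd (τ w))
    (t : relNormOneInfUnits (Fp L) L) (f : FinSB (Fp L) (Fin n)) :
    adelicMpCont.omega (Fp L) (Fin n) (gramA L e dV hdV dW hdW)
        (chiSplitting L e dV hdV hdV0 dW hdW hdW0 χ hχu hχs (centerPair L dV dW (archUnit L t)))
        (piSchwartzBruhatEquiv (Fp L) (Fin n) (gaussianV L e dV hdV hdV0 dW hdW hdW0 ⊗ₜ f)) =
      ((((etaD L e dV hdV dW hdW τ (archK L e dV hdV dW hdW t) : ℂˣ) : ℂ)) *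
          MpS.vac (sectionD L e dV hdV hdV0 dW hdW hdW0 (archK L e dV hdV dW hdW t))) •
        piSchwartzBruhatEquiv (Fp L) (Fin n) (gaussianV L e dV hdV hdV0 dW hdW hdW0 ⊗ₜ f) := by
  have hu := (exists_proj_sectionD_archK L e dV hdV hdV0 dW hdW hdW0 t).choose_spec
  -- `chiSplitting χ g = undouble (doubledWeilRep χ) g` definitionally (`chiSplitting`, `undoubleHom_apply`)
  show adelicMpCont.omega (Fp L) (Fin n) (gramA L e dV hdV dW hdW)
      (undouble L e dV hdV hdV0 dW hdW hdW0 (isDoubledWeilRep_doubledWeilRep L e dV hdV hdV0 dW hdW hdW0 χ hχu hχs).proj_eq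
        (centerPair L dV dW (archUnit L t))) _ = _
  -- the doubled operator at `((t·1_V) ⊗ 1_W) ⊕ 1 = (k_t, 1)` is the explicit archimedean half at `k_t`
  have h1 : doubledWeilRep L e dV hdV hdV0 dW hdW hdW0 χ hχu hχs (inlG L e dV hdV dW hdW (centerPair L dV dW (archUnit L t))) =
      archHalfOf L e dV hdV hdV0 dW hdW hdW0 τ (archK L e dV hdV dW hdW t) :=
    (DFunLike.congr_arg (doubledWeilRep L e dV hdV hdV0 dW hdW hdW0 χ hχu hχs) (archToAdelic_archK L e dV hdV dW hdW t)).symm.trans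
      (doubledWeilRep_archToAdelic_eq_archHalfOf L e dV hdV hdV0 dW hdW hdW0 hχu hχs hτ hodd (archK L e dV hdV dW hdW t))
  have hrew : ∀ (a : 𝓢((Fin (n + n) → mixedSpace (Fp L)), ℂ)) (f' : FinSB (Fp L) (Fin (n + n))),
      adelicMpCont.omega (Fp L) (Fin (n + n)) (gramDA L e dV hdV dW hdW)
          (doubledWeilRep L e dV hdV hdV0 dW hdW hdW0 χ hχu hχs (inlG L e dV hdV dW hdW (centerPair L dV dW (archUnit L t))))
          (piSchwartzBruhatEquiv (Fp L) (Fin (n + n)) (a ⊗ₜ f')) =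
        adelicMpCont.omega (Fp L) (Fin (n + n)) (gramDA L e dV hdV dW hdW)
          (archHalfOf L e dV hdV hdV0 dW hdW hdW0 τ (archK L e dV hdV dW hdW t))
          (piSchwartzBruhatEquiv (Fp L) (Fin (n + n)) (a ⊗ₜ f')) := fun a f' =>
    congrArg (fun q : MpD L e dV hdV dW hdW =>
      adelicMpCont.omega (Fp L) (Fin (n + n)) (gramDA L e dV hdV dW hdW) q (piSchwartzBruhatEquiv (Fp L) (Fin (n + n)) (a ⊗ₜ f'))) h1
  -- (for `f = 0` both sides vanish; otherwise `G_𝕍 ⊗ f` itself is the non-zero second factor)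
  by_cases hf : f = 0
  · subst hf
    simp only [TensorProduct.tmul_zero, map_zero, smul_zero]
  refine omega_undouble_tmul_eq_smul_of_arch L e dV hdV hdV0 dW hdW hdW0 _ _ (centerPair L dV dW (archUnit L t))
    (fun a f' => (hrew a f').trans (omega_archHalfOf_tmul L e dV hdV hdV0 dW hdW hdW0 τ (archK L e dV hdV dW hdW t) a f'))
    (gaussianV L e dV hdV hdV0 dW hdW hdW0) (gaussianV L e dV hdV hdV0 dW hdW hdW0) f f ?_
    (piSchwartzBruhatEquiv_tmul_ne_zero (gaussianV_ne_zero L e dV hdV hdV0 dW hdW hdW0) hf)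
  -- the eigenvalue of `e^* s^𝔻(k_t) e_*` on `R_{e₂}(G_𝕍 ⊠ G_𝕍) = h₀ ∘ frameD` is `vac (sectionD k_t)`
  rw [schwartzReindexCLM_archBoxTensor_gaussianV]
  rw [follandHermite, carrierConjEquiv_apply, ContinuousLinearEquiv.apply_symm_apply,
    MpS.apply_hermitePi_zero_of_proj_eq_realifySp hu, map_smul]

end Assembly

/-! ## §2 The eigenvalue as a typed archimedean weight `archWeight L m t` -/

section Weight

/-- the real place of `L⁺` under an infinite place of the CM field `L`. [folklore] -/
def realPlaceUnder (w : InfinitePlace L) : {v : InfinitePlace (Fp L) // v.IsReal} :=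
  ⟨w.comap (algebraMap (Fp L) L), IsTotallyReal.isReal _⟩

/-- `realPlaceUnder (cmPlaceOver v) = v`. [folklore] -/
private theorem realPlaceUnder_cmPlaceOver (v : {v : InfinitePlace (Fp L) // v.IsReal}) :
    realPlaceUnder L (cmPlaceOver L v).1 = v :=
  Subtype.ext (cmPlaceOver_comap L v)

/-- `cmPlaceOver (realPlaceUnder w) = w` (every infinite place of `L` is THE complex place over its restriction). [folklore] -/
private theorem cmPlaceOver_realPlaceUnder (w : InfinitePlace L) : (cmPlaceOver L (realPlaceUnder L w)).1 = w :=
  (cmPlaceOver_eq_mk L _ w.embedding (by rw [mk_embedding]; rfl)).trans (mk_embedding w)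

/-- `v ↦ w(v)`: the real places of `L⁺` ≃ the infinite places of `L`. [folklore] -/
def realPlaceEquiv : {v : InfinitePlace (Fp L) // v.IsReal} ≃ InfinitePlace L where
  toFun v := (cmPlaceOver L v).1
  invFun := realPlaceUnder L
  left_inv := realPlaceUnder_cmPlaceOver L
  right_inv := cmPlaceOver_realPlaceUnder L

/-- a product over the infinite places of `L` is a product over the real places of `L⁺` along `v ↦ w(v)`. [folklore] -/
private theorem prod_cmPlaceOver {A : Type*} [CommMonoid A] (f : InfinitePlace L → A) :
    ∏ v : {v : InfinitePlace (Fp L) // v.IsReal}, f (cmPlaceOver L v).1 = ∏ w, f w :=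
  Fintype.prod_equiv (realPlaceEquiv L) (fun v => f (cmPlaceOver L v).1) f fun _ => rfl

/-- **the CENTRAL TYPE of the splitting attached to a character of odd unitary archimedean type `(τ, 0)`** on the Gaussian of the pair
`(diag dV, diag dW)`: `m_w = n (τ_w + 1)/2 − q_{v(w)}` with `q_v` the number of negative signs of `T_V ⊗ T_W` at `v` — i.e.
`m_w = (n τ_w + p_{v(w)} − q_{v(w)})/2`, Konno–Konno's `p e_P + q e_Q` with `(e_P, e_Q) = ((τ_w+1)/2, (τ_w−1)/2)`.
[cite: KonnoKonno2007, Lemma 5.2 p. 73] [cite: Paul1998, §1.2 (1.2.1)–(1.2.2)] -/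
def centralType (τ : InfinitePlace L → ℤ) (w : InfinitePlace L) : ℤ :=
  (n : ℤ) * ((τ w + 1) / 2) - (negCount L e dV hdV dW hdW (realPlaceUnder L w) : ℤ)

/-- **`η_τ(k_t) · vac (sectionD k_t) = archWeight L m t`** with `m = centralType τ`. [cite: KonnoKonno2007, Lemma 5.2 p. 73]
[cite: Paul1998, §1.2 (1.2.1)–(1.2.2)] -/
theorem etaD_mul_vac_archK (τ : InfinitePlace L → ℤ) (t : relNormOneInfUnits (Fp L) L) :
    (((etaD L e dV hdV dW hdW τ (archK L e dV hdV dW hdW t) : ℂˣ) : ℂ)) *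
        MpS.vac (sectionD L e dV hdV hdV0 dW hdW hdW0 (archK L e dV hdV dW hdW t)) =
      archWeight L (centralType L e dV hdV dW hdW τ) t := by
  rw [coe_etaD_archK, vac_sectionD_archK, archWeight_eq_prod,
    ← prod_cmPlaceOver L fun w => ((archPlaceChar L w t : Circle) : ℂ) ^ centralType L e dV hdV dW hdW τ w,
    ← Finset.prod_inv_distrib, ← Finset.prod_mul_distrib]
  refine Finset.prod_congr rfl fun v _ => ?_
  have hz : ((archPlaceChar L (cmPlaceOver L v).1 t : Circle) : ℂ) ≠ 0 := Circle.coe_ne_zero _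
  rw [centralType, realPlaceUnder_cmPlaceOver, zpow_sub₀ hz, zpow_mul, zpow_natCast, zpow_natCast, div_eq_mul_inv]

end Weight

/-! ## §3 The pair-representation forms: the `h₀` input of `Def411WeilCarriersCentralTypeRigidity` -/

section PairRep

open Literature.NumberTheory.Automorphic.Liu2021.Def411WeilCarriersDoubling (doubledWeilRep chiSplitting chiSplittingLine
  splittingCongr lineW complexConj_lineW lineW_ne_zero realDiagonal_lineW diagonal_lineW isDoubledWeilRep_doubledWeilRep)

/-- **(E1) AT THE LANE DATUM** `(diag dV, diag dW)`: through `ω_ψ ∘ ι_χ` the archimedean centre `(t · 1_V, 1)`, `t ∈ U(1)(L⁺ ⊗ ℝ)`, acts on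
`G_𝕍 ⊗ f` by the typed weight `archWeight L (centralType τ) t` — the CENTRAL TYPE of the splitting attached to `χ` is `centralType τ`,
for `χ` of odd unitary archimedean type `(τ, 0)`. [cite: GelbartRogawski1991, §3.1 Prop. 3.1.1 p. 455, Remark p. 457 L9–13]
[cite: KonnoKonno2007, Lemma 5.2 p. 73] [cite: Liu2021, App. D §D.1 Step 2 (l. 5219), Lem. D.2] -/
theorem pairRep_chiSplitting_center_gaussianV_tmul {χ : HeckeCharacter L} (hχu : χ.IsUnitary) (hχs : IsSplittingChar L 1 χ)
    {τ : InfinitePlace L → ℤ} (hτ : χ.HasUnitaryArchType τ 0) (hodd : ∀ w, Odd (τ w))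
    (t : relNormOneInfUnits (Fp L) L) (f : FinSB (Fp L) (Fin n)) :
    pairRep (Fp L) L (IsCMField.complexConj L) N M e (Matrix.diagonal dV) (Matrix.diagonal dW)
        (chiSplitting L e dV hdV hdV0 dW hdW hdW0 χ hχu hχs) (CMCenter L dV (archUnit L t), 1)
        (piSchwartzBruhatEquiv (Fp L) (Fin n) (gaussianV L e dV hdV hdV0 dW hdW hdW0 ⊗ₜ f)) =
      archWeight L (centralType L e dV hdV dW hdW τ) t •
        piSchwartzBruhatEquiv (Fp L) (Fin n) (gaussianV L e dV hdV hdV0 dW hdW hdW0 ⊗ₜ f) := by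
  -- `s_pair (x, 1) = s (x ⊗ 1 · 1 ⊗ 1) = s (x ⊗ 1)` (term-mode bookkeeping; `rw` on these goals is slow)
  have h1 : UnitaryGroup.adelicInl (Fp L) L (IsCMField.complexConj L) N M (Matrix.diagonal dV) (Matrix.diagonal dW)
        (CMCenter L dV (archUnit L t)) *
      UnitaryGroup.adelicInr (Fp L) L (IsCMField.complexConj L) N M (Matrix.diagonal dV) (Matrix.diagonal dW) 1 =
      centerPair L dV dW (archUnit L t) := by
    rw [MonoidHom.map_one, mul_one]
  have h : pairSplitting (Fp L) L (IsCMField.complexConj L) N M e (Matrix.diagonal dV) (Matrix.diagonal dW)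
      (chiSplitting L e dV hdV hdV0 dW hdW hdW0 χ hχu hχs) (CMCenter L dV (archUnit L t), 1) =
      chiSplitting L e dV hdV hdV0 dW hdW hdW0 χ hχu hχs (centerPair L dV dW (archUnit L t)) :=
    (pairSplitting_apply (Fp L) L (IsCMField.complexConj L) N M e (Matrix.diagonal dV) (Matrix.diagonal dW) _ _).trans
      (congrArg (chiSplitting L e dV hdV hdV0 dW hdW hdW0 χ hχu hχs) h1)
  exact ((congrArg (fun q => adelicMpCont.omega (Fp L) (Fin n) (gramA L e dV hdV dW hdW) q
    (piSchwartzBruhatEquiv (Fp L) (Fin n) (gaussianV L e dV hdV hdV0 dW hdW hdW0 ⊗ₜ f))) h).trans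
    (omega_chiSplitting_centerPair_gaussianV_tmul L e dV hdV hdV0 dW hdW hdW0 hχu hχs hτ hodd t f)).trans
    (congrArg (fun z : ℂ => z • piSchwartzBruhatEquiv (Fp L) (Fin n) (gaussianV L e dV hdV hdV0 dW hdW hdW0 ⊗ₜ f))
      (etaD_mul_vac_archK L e dV hdV hdV0 dW hdW hdW0 τ t))

variable {F E : Type} [Field F] [NumberField F] [Field E] [NumberField E] [Algebra F E] (c : E ≃ₐ[F] E) in
/-- transport of the pair representation at `(x, 1)` along equal W-side Gram data (`splittingCongr`). [cite: GelbartRogawski1991, §3.1 Prop. 3.1.1 p. 455 L1–3] -/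
theorem pairRep_splittingCongr_inl_one {N' M' n' : ℕ} (e' : Fin N' × Fin M' ≃ Fin n') (JV : Matrix (Fin N') (Fin N') E)
    {TV : Matrix (Fin N') (Fin N') F} {TW TW' : Matrix (Fin M') (Fin M') F} {JW JW' : Matrix (Fin M') (Fin M') E}
    (hT : TW = TW') (hJ : JW = JW')
    (s : UnitaryGroup.adelicPair F E c N' M' JV JW →* adelicMpCont F (Fin n') (adelicGram F e' TV TW))
    (x : UnitaryGroup.adelic F E c N' JV) (Φ : piSchwartzBruhat F (Fin n')) :
    pairRep F E c N' M' e' JV JW' (splittingCongr F E c N' M' e' JV hT hJ s) (x, 1) Φ = pairRep F E c N' M' e' JV JW s (x, 1) Φ := by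
  subst hT hJ
  rfl

variable (e₁ : Fin N × Fin 1 ≃ Fin n)

/-- **(E1) AT THE HERMITIAN LINE `⟨T_W⟩`** — LITERALLY the `h₀` hypothesis of `exists_eq_chiSplittingLine_archType_of_center` ∕
`…_archTrivial_of_center_eq` at `Φ₀ := G_𝕍 ⊗ f`: through `ω_ψ ∘ ι_χ`, `ι_χ = chiSplittingLine χ T_W J_W`, the archimedean centre
`(t · 1_V, 1)` acts on `G_𝕍 ⊗ f` by `archWeight L (centralType τ) t` (`dW := lineW T_W`), for `χ` of odd unitary archimedean type `(τ, 0)`.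
[cite: GelbartRogawski1991, §3.1 Prop. 3.1.1 p. 455, Remark p. 457 L9–13] [cite: KonnoKonno2007, Lemma 5.2 p. 73]
[cite: Liu2021, App. D §D.1 Step 2 (l. 5219), Lem. D.2] -/
theorem pairRep_chiSplittingLine_center_gaussianV_tmul {χ : HeckeCharacter L} (hχu : χ.IsUnitary) (hχs : IsSplittingChar L 1 χ)
    {τ : InfinitePlace L → ℤ} (hτ : χ.HasUnitaryArchType τ 0) (hodd : ∀ w, Odd (τ w))
    (TW : Matrix (Fin 1) (Fin 1) (Fp L)) (hWd : IsUnit TW.det) (JW : Matrix (Fin 1) (Fin 1) L)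
    (hJW : JW = TW.map (algebraMap (Fp L) L)) (t : relNormOneInfUnits (Fp L) L) (f : FinSB (Fp L) (Fin n)) :
    pairRep (Fp L) L (IsCMField.complexConj L) N 1 e₁ (Matrix.diagonal dV) JW
        (chiSplittingLine L e₁ dV hdV hdV0 χ hχu hχs TW hWd JW hJW) (CMCenter L dV (archUnit L t), 1)
        (piSchwartzBruhatEquiv (Fp L) (Fin n)
          (gaussianV L e₁ dV hdV hdV0 (lineW L TW) (complexConj_lineW L TW) (lineW_ne_zero L TW hWd) ⊗ₜ f)) =
      archWeight L (centralType L e₁ dV hdV (lineW L TW) (complexConj_lineW L TW) τ) t •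
        piSchwartzBruhatEquiv (Fp L) (Fin n)
          (gaussianV L e₁ dV hdV hdV0 (lineW L TW) (complexConj_lineW L TW) (lineW_ne_zero L TW hWd) ⊗ₜ f) :=
  (pairRep_splittingCongr_inl_one (IsCMField.complexConj L) e₁ (Matrix.diagonal dV) (realDiagonal_lineW L TW)
      (diagonal_lineW L TW hJW) _ _ _).trans
    (pairRep_chiSplitting_center_gaussianV_tmul L e₁ dV hdV hdV0 (lineW L TW) (complexConj_lineW L TW)
      (lineW_ne_zero L TW hWd) hχu hχs hτ hodd t f)

/-- `gaussianV` depends on the entry family `dW` only (not on the proofs carried with it). [folklore] -/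
private theorem gaussianV_congr {dW dW' : Fin M → L} (hdW : ∀ i, IsCMField.complexConj L (dW i) = dW i) (hdW0 : ∀ i, dW i ≠ 0)
    (hdW' : ∀ i, IsCMField.complexConj L (dW' i) = dW' i) (hdW0' : ∀ i, dW' i ≠ 0) (h : dW = dW') :
    gaussianV L e dV hdV hdV0 dW hdW hdW0 = gaussianV L e dV hdV hdV0 dW' hdW' hdW0' := by
  subst h
  rfl

/-- `centralType` depends on the entry family `dW` only. [folklore] -/
private theorem centralType_congr {dW dW' : Fin M → L} (hdW : ∀ i, IsCMField.complexConj L (dW i) = dW i)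
    (hdW' : ∀ i, IsCMField.complexConj L (dW' i) = dW' i) (h : dW = dW') (τ : InfinitePlace L → ℤ) :
    centralType L e dV hdV dW hdW τ = centralType L e dV hdV dW' hdW' τ := by
  subst h
  rfl

/-- `lineW (realDiagonal dW) = dW`: the entry family of the real diagonal `1 × 1` matrix of `dW` is `dW`. [folklore] -/
private theorem lineW_realDiagonal (dW₁ : Fin 1 → L) (hdW₁ : ∀ i, IsCMField.complexConj L (dW₁ i) = dW₁ i) :
    lineW L (realDiagonal L dW₁ hdW₁) = dW₁ :=
  funext fun i => by
    show (((realDiagonal L dW₁ hdW₁) i i : Fp L) : L) = dW₁ i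
    rw [realDiagonal_eq_diagonal, Matrix.diagonal_apply_eq]
    rfl

/-- **(E1) IN THE CM CURRENCY OF THE COR-CM PIN** (`T_W := realDiagonal dW`, `J_W := diagonal dW`, the shape of
`LiuIndex.HasCentralTypeAt` ∕ `exists_eq_chiSplittingLine_archTrivial_of_center_eq_cm`): through `ω_ψ ∘ ι_χ` the archimedean centre
`(t · 1_V, 1)` acts on `G_𝕍 ⊗ f` (`G_𝕍 = gaussianV … dW …`) by `archWeight L (centralType τ) t`. [cite: Liu2021, App. D §D.1 Step 2 (l. 5219), Lem. D.2]
[cite: KonnoKonno2007, Lemma 5.2 p. 73] [cite: GelbartRogawski1991, §3.1 Prop. 3.1.1 p. 455, Remark p. 457 L9–13] -/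
theorem pairRep_chiSplittingLine_center_gaussianV_tmul_cm {χ : HeckeCharacter L} (hχu : χ.IsUnitary) (hχs : IsSplittingChar L 1 χ)
    {τ : InfinitePlace L → ℤ} (hτ : χ.HasUnitaryArchType τ 0) (hodd : ∀ w, Odd (τ w))
    (dW₁ : Fin 1 → L) (hdW₁ : ∀ i, IsCMField.complexConj L (dW₁ i) = dW₁ i) (hdW₁0 : ∀ i, dW₁ i ≠ 0)
    (t : relNormOneInfUnits (Fp L) L) (f : FinSB (Fp L) (Fin n)) :
    pairRep (Fp L) L (IsCMField.complexConj L) N 1 e₁ (Matrix.diagonal dV) (Matrix.diagonal dW₁)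
        (chiSplittingLine L e₁ dV hdV hdV0 χ hχu hχs (realDiagonal L dW₁ hdW₁) (isUnit_det_realDiagonal L dW₁ hdW₁ hdW₁0)
          (Matrix.diagonal dW₁) (realDiagonal_map L dW₁ hdW₁).symm) (CMCenter L dV (archUnit L t), 1)
        (piSchwartzBruhatEquiv (Fp L) (Fin n) (gaussianV L e₁ dV hdV hdV0 dW₁ hdW₁ hdW₁0 ⊗ₜ f)) =
      archWeight L (centralType L e₁ dV hdV dW₁ hdW₁ τ) t •
        piSchwartzBruhatEquiv (Fp L) (Fin n) (gaussianV L e₁ dV hdV hdV0 dW₁ hdW₁ hdW₁0 ⊗ₜ f) := by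
  have hl := lineW_realDiagonal L dW₁ hdW₁
  rw [← gaussianV_congr L e₁ dV hdV hdV0 (complexConj_lineW L (realDiagonal L dW₁ hdW₁))
      (lineW_ne_zero L (realDiagonal L dW₁ hdW₁) (isUnit_det_realDiagonal L dW₁ hdW₁ hdW₁0)) hdW₁ hdW₁0 hl,
    ← centralType_congr L e₁ dV hdV (complexConj_lineW L (realDiagonal L dW₁ hdW₁)) hdW₁ hl τ]
  exact pairRep_chiSplittingLine_center_gaussianV_tmul L dV hdV hdV0 e₁ hχu hχs hτ hodd (realDiagonal L dW₁ hdW₁)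
    (isUnit_det_realDiagonal L dW₁ hdW₁ hdW₁0) (Matrix.diagonal dW₁) (realDiagonal_map L dW₁ hdW₁).symm t f

end PairRep

/-! ## §4 Weight-one base characters: the `h₀` DISCHARGED, and X3-Char item (E) with no analytic hypothesis -/

section WeightOne

open Literature.NumberTheory.Automorphic.Liu2021.Def411WeilCarriersDoubling
open Literature.NumberTheory.GelbartRogawski1991.GRConstruction.DoubledWeilDetTwist
open Literature.NumberTheory.Automorphic.UnitaryGroup.AdelicCharactersArchType
open Literature.NumberTheory.Automorphic.IdeleClassGroup

variable (e₁ : Fin N × Fin 1 ≃ Fin n)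

omit [NumberField L] [IsCMField L] in
/-- `weightOneType Φ` is odd at every place (its values are `±1`). [cite: Liu2021, Remark 4.2] -/
theorem odd_weightOneType (Φ : Literature.AlgebraicGeometry.Motives.CMType L) (w : InfinitePlace L) :
    Odd (weightOneType L Φ w) := by
  unfold weightOneType
  split_ifs <;> decide

/-- **(E1) FOR A WEIGHT-ONE BASE CHARACTER**: for `μ₀` conjugate symplectic of weight one with CM type `Φ`, the archimedean centre acts
through `ω_ψ ∘ ι_{μ₀}` (`ι_{μ₀} = chiSplittingLine (toHeckeCharacter μ₀) …`) on `G_𝕍 ⊗ f` by `archWeight L (centralType (weightOneType Φ)) t` —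
LITERALLY the `h₀` of `exists_eq_chiSplittingLine_twist_weightOne_of_center_eq_cm` at `Φ₀ := G_𝕍 ⊗ f`, now a theorem.
[cite: Liu2021, Def. 4.3, App. D §D.1 Step 2 (l. 5219), Lem. D.2] [cite: KonnoKonno2007, Lemma 5.2 p. 73] -/
theorem pairRep_chiSplittingLine_toHeckeCharacter_center_gaussianV_tmul_cm (μ₀ : IdeleClassGroup L →ₜ* Circle)
    (hμ₀ : IsConjugateSymplectic L μ₀) (hw : HasWeight L μ₀ 1) {Φ : Literature.AlgebraicGeometry.Motives.CMType L}
    (hΦ : HasCMType L μ₀ Φ)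
    (dW₁ : Fin 1 → L) (hdW₁ : ∀ i, IsCMField.complexConj L (dW₁ i) = dW₁ i) (hdW₁0 : ∀ i, dW₁ i ≠ 0)
    (t : relNormOneInfUnits (Fp L) L) (f : FinSB (Fp L) (Fin n)) :
    pairRep (Fp L) L (IsCMField.complexConj L) N 1 e₁ (Matrix.diagonal dV) (Matrix.diagonal dW₁)
        (chiSplittingLine L e₁ dV hdV hdV0 (toHeckeCharacter L μ₀) (isUnitary_toHeckeCharacter L μ₀)
          (isSplittingChar_toHeckeCharacter_of_isConjugateSymplectic L μ₀ hμ₀) (realDiagonal L dW₁ hdW₁)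
          (isUnit_det_realDiagonal L dW₁ hdW₁ hdW₁0) (Matrix.diagonal dW₁) (realDiagonal_map L dW₁ hdW₁).symm)
        (CMCenter L dV (archUnit L t), 1)
        (piSchwartzBruhatEquiv (Fp L) (Fin n) (gaussianV L e₁ dV hdV hdV0 dW₁ hdW₁ hdW₁0 ⊗ₜ f)) =
      archWeight L (centralType L e₁ dV hdV dW₁ hdW₁ (weightOneType L Φ)) t •
        piSchwartzBruhatEquiv (Fp L) (Fin n) (gaussianV L e₁ dV hdV hdV0 dW₁ hdW₁ hdW₁0 ⊗ₜ f) :=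
  pairRep_chiSplittingLine_center_gaussianV_tmul_cm L dV hdV hdV0 e₁ (isUnitary_toHeckeCharacter L μ₀)
    (isSplittingChar_toHeckeCharacter_of_isConjugateSymplectic L μ₀ hμ₀)
    ((hasUnitaryArchType_toHeckeCharacter_iff L μ₀ _).2 (hasInfinityType_weightOneType_of_hasWeight_one L hw hΦ))
    (odd_weightOneType L Φ) dW₁ hdW₁ hdW₁0 t f

/-- **X3-CHAR ITEM (E) AT A GRAM SCALAR, WITH NO ANALYTIC HYPOTHESIS**: at the CM datum `(diag dV, ⟨dW 0⟩)` (modulo the displayed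
predicate `hA`, discharged for rank 3 by `UnitaryGroupAdelicCharactersDetPair`), every CONTINUOUS compatible splitting `s` through which
the archimedean centre acts on `G_𝕍 ⊗ f` (`f ≠ 0`) by `archWeight L (centralType (weightOneType Φ)) t` — the central type of
`ι_{μ₀}` for ANY `μ₀` conjugate symplectic of weight one with CM type `Φ` — IS `ι_μ` for `μ := μ₀ ⊛ α` conjugate symplectic OF
WEIGHT ONE with `Φ_μ = Φ` (`exists_eq_chiSplittingLine_twist_weightOne_of_center_eq_cm` with its `h₀` supplied by this file).
[cite: Liu2021, Def. 4.3, App. D §D.1 Step 2 (l. 5219), Lem. D.2] [cite: GelbartRogawski1991, §3.1 Remark p. 457 L4–13]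
[cite: KonnoKonno2007, Lemma 5.2 p. 73] -/
theorem exists_eq_chiSplittingLine_twist_weightOne_of_center_gaussianV_cm [NeZero N]
    (dW₁ : Fin 1 → L) (hdW₁ : ∀ i, IsCMField.complexConj L (dW₁ i) = dW₁ i) (hdW₁0 : ∀ i, dW₁ i ≠ 0)
    (μ₀ : IdeleClassGroup L →ₜ* Circle) (hμ₀ : IsConjugateSymplectic L μ₀)
    (hA : CentralCharFactorsThroughDet (Fp L) L (IsCMField.complexConj L) N 1 e₁ (Matrix.diagonal dV) (Matrix.diagonal dW₁)
      (det_reindex_kronecker_diagonal_line_ne_zero L e₁ dV hdV0 (realDiagonal L dW₁ hdW₁)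
        (isUnit_det_realDiagonal L dW₁ hdW₁ hdW₁0) (Matrix.diagonal dW₁) (realDiagonal_map L dW₁ hdW₁).symm))
    (hw : HasWeight L μ₀ 1) {Φ : Literature.AlgebraicGeometry.Motives.CMType L} (hΦ : HasCMType L μ₀ Φ)
    {s : UnitaryGroup.adelicPair (Fp L) L (IsCMField.complexConj L) N 1 (Matrix.diagonal dV) (Matrix.diagonal dW₁) →*
      adelicMpCont (Fp L) (Fin n) (adelicGram (Fp L) e₁ (realDiagonal L dV hdV) (realDiagonal L dW₁ hdW₁))}
    (hsc : Continuous s) (hs : (cmSplittingDatum L e₁ dV hdV hdV0 dW₁ hdW₁ hdW₁0).IsCompatible s)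
    {f : FinSB (Fp L) (Fin n)} (hf : f ≠ 0)
    (h : ∀ t, pairRep (Fp L) L (IsCMField.complexConj L) N 1 e₁ (Matrix.diagonal dV) (Matrix.diagonal dW₁) s
        (CMCenter L dV (archUnit L t), 1) (piSchwartzBruhatEquiv (Fp L) (Fin n) (gaussianV L e₁ dV hdV hdV0 dW₁ hdW₁ hdW₁0 ⊗ₜ f)) =
      archWeight L (centralType L e₁ dV hdV dW₁ hdW₁ (weightOneType L Φ)) t •
        piSchwartzBruhatEquiv (Fp L) (Fin n) (gaussianV L e₁ dV hdV hdV0 dW₁ hdW₁ hdW₁0 ⊗ₜ f)) :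
    ∃ (α : CMAdelicOne L →* ℂˣ) (hα : Continuous α)
      (hαrat : ∀ u : CMAdelicOne L, (u : ideleGroup L) ∈ principalIdeles L → α u = 1)
      (hαu : ∀ u, ‖((α u : ℂˣ) : ℂ)‖ = 1) (hμ : IsConjugateSymplectic L (twist L α hα hαrat μ₀)),
      s = chiSplittingLine L e₁ dV hdV hdV0 (toHeckeCharacter L μ₀ * ratioHecke L α hα hαrat)
            (isUnitary_mul_ratioHecke L (isUnitary_toHeckeCharacter L μ₀) hα hαrat hαu)
            ((isSplittingChar_mul_ratioHecke_iff L 1 _ hα hαrat).2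
              (isSplittingChar_toHeckeCharacter_of_isConjugateSymplectic L μ₀ hμ₀))
            (realDiagonal L dW₁ hdW₁) (isUnit_det_realDiagonal L dW₁ hdW₁ hdW₁0) (Matrix.diagonal dW₁)
            (realDiagonal_map L dW₁ hdW₁).symm ∧
        toHeckeCharacter L (twist L α hα hαrat μ₀) = toHeckeCharacter L μ₀ * ratioHecke L α hα hαrat ∧
        HasWeight L (twist L α hα hαrat μ₀) 1 ∧ hμ.cmType = Φ :=
  exists_eq_chiSplittingLine_twist_weightOne_of_center_eq_cm L e₁ dV hdV hdV0 dW₁ hdW₁ hdW₁0 μ₀ hμ₀ hA hw hΦ hsc hs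
    (piSchwartzBruhatEquiv_tmul_ne_zero (gaussianV_ne_zero L e₁ dV hdV hdV0 dW₁ hdW₁ hdW₁0) hf)
    (pairRep_chiSplittingLine_toHeckeCharacter_center_gaussianV_tmul_cm L dV hdV hdV0 e₁ μ₀ hμ₀ hw hΦ dW₁ hdW₁ hdW₁0 · f) h

end WeightOne

end Literature.NumberTheory.GelbartRogawski1991.GRConstruction

end
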